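import Mathlib
import Summits.Ventures.PercRepro2.TypedSwitchingFour

/-!
# The primed (separation) form of the switching move m9 (blind cell PercRepro2, p3 g11,
2026-08-26; `proofs/P3-M9.md` §1, `proofs/subclaims/S2-SEPARATED.md` §4f (21))

On the six bits `(p~q, p~r, p~s, q~r, q~s, r~s)` of a state the move **m9** of P3-SWITCH §4 reads
`c(σ x = pq|rs, σ y = SEP) ≤ c(σ x = pq|r|s, σ y = rs|p|q)`.  Write `S(s)` for «no cross bit
of `s` is set» (`{p,q}` and `{r,s}` are in different blocks) and `pq(s)`, `rs(s)` for the two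
pair bits.  The **primed form** drops the «only» conditions: with `Sep := S(σ x) ∧ S(σ y)`,

  `c(Sep ∧ pq(σ x) ∧ rs(σ x)) ≤ c(Sep ∧ pq(σ x) ∧ rs(σ y))`

(«given mutual separation in both copies, the pair `r, s` prefers the copy opposite to the one
connecting `p, q`»).  The two differences are EQUAL (`typedCount_m9_primed_identity`): the classes
where `p, q` are connected in both copies or `r, s` are connected in both copies cancel, one of them
after the copy reflection `typedCount_swap12`.  Hence `m9 ↔ m9'` (`typedCount_m9_iff_primed`).
Nothing here needs the state map to be a connectivity: any monotone `σ` and any spectator weight.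
In the sign form: `m9 ⟺ Σ_{Sep} (pq(x) − pq(y))·(rs(x) − rs(y)) ≤ 0`
(`typedCount_m9_iff_sign`), i.e. a NEGATIVE correlation of the colour preferences of the two pairs
given their separation.  Own work; standard axioms.
-/

namespace Summit.Ventures.PercRepro2

namespace CovForm

namespace PairHarris

open Classical TypedA3

/-- The six-bit state `(p~q, p~r, p~s, q~r, q~s, r~s)`. -/
abbrev St6 := Bool × Bool × Bool × Bool × Bool × Bool

/-- `{p, q}` and `{r, s}` are separated in the state: the four cross bits are off. -/
def sepSt (s : St6) : Bool :=
  !s.2.1 && !s.2.2.1 && !s.2.2.2.1 && !s.2.2.2.2.1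

/-- The `p~q` bit. -/
def pqSt (s : St6) : Bool := s.1

/-- The `r~s` bit. -/
def rsSt (s : St6) : Bool := s.2.2.2.2.2

/-- The source state of m9, `pq|rs`, is «separated, `p~q`, `r~s`». -/
lemma eq_pqrs_iff (s : St6) :
    s = (true, false, false, false, false, true) ↔ sepSt s = true ∧ pqSt s = true ∧ rsSt s = true := by
  obtain ⟨a, b, c, d, e, f⟩ := s
  simp only [sepSt, pqSt, rsSt, Prod.mk.injEq]
  cases a <;> cases b <;> cases c <;> cases d <;> cases e <;> cases f <;> simp

/-- The bottom state `SEP` is «separated, no `p~q`, no `r~s`». -/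
lemma eq_sep_iff (s : St6) :
    s = (false, false, false, false, false, false) ↔
      sepSt s = true ∧ pqSt s = false ∧ rsSt s = false := by
  obtain ⟨a, b, c, d, e, f⟩ := s
  simp only [sepSt, pqSt, rsSt, Prod.mk.injEq]
  cases a <;> cases b <;> cases c <;> cases d <;> cases e <;> cases f <;> simp

/-- The state `pq|r|s` is «separated, `p~q`, no `r~s`». -/
lemma eq_pq_iff (s : St6) :
    s = (true, false, false, false, false, false) ↔
      sepSt s = true ∧ pqSt s = true ∧ rsSt s = false := by
  obtain ⟨a, b, c, d, e, f⟩ := s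
  simp only [sepSt, pqSt, rsSt, Prod.mk.injEq]
  cases a <;> cases b <;> cases c <;> cases d <;> cases e <;> cases f <;> simp

/-- The state `rs|p|q` is «separated, no `p~q`, `r~s`». -/
lemma eq_rs_iff (s : St6) :
    s = (false, false, false, false, false, true) ↔
      sepSt s = true ∧ pqSt s = false ∧ rsSt s = true := by
  obtain ⟨a, b, c, d, e, f⟩ := s
  simp only [sepSt, pqSt, rsSt, Prod.mk.injEq]
  cases a <;> cases b <;> cases c <;> cases d <;> cases e <;> cases f <;> simp

section Identity

variable {E : Type*} [Fintype E] [DecidableEq E] {R : Type*} [Field R]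

/-- The source kernel of m9: `g(σ w)·1[σ x = pq|rs]·1[σ y = SEP]`. -/
noncomputable def kerM9Src (σ : Config E → St6) (g : St6 → R) (x y w : Config E) : R :=
  g (σ w) * ((if σ x = (true, false, false, false, false, true) then (1 : R) else 0) *
    (if σ y = (false, false, false, false, false, false) then (1 : R) else 0))

/-- The target kernel of m9: `g(σ w)·1[σ x = pq|r|s]·1[σ y = rs|p|q]`. -/
noncomputable def kerM9Tgt (σ : Config E → St6) (g : St6 → R) (x y w : Config E) : R :=
  g (σ w) * ((if σ x = (true, false, false, false, false, false) then (1 : R) else 0) *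
    (if σ y = (false, false, false, false, false, true) then (1 : R) else 0))

/-- The primed source kernel: `g(σ w)·1[Sep ∧ pq(σ x) ∧ rs(σ x)]`. -/
noncomputable def kerM9Src' (σ : Config E → St6) (g : St6 → R) (x y w : Config E) : R :=
  g (σ w) * (if sepSt (σ x) = true ∧ sepSt (σ y) = true ∧ pqSt (σ x) = true ∧ rsSt (σ x) = true
    then (1 : R) else 0)

/-- The primed target kernel: `g(σ w)·1[Sep ∧ pq(σ x) ∧ rs(σ y)]`. -/
noncomputable def kerM9Tgt' (σ : Config E → St6) (g : St6 → R) (x y w : Config E) : R :=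
  g (σ w) * (if sepSt (σ x) = true ∧ sepSt (σ y) = true ∧ pqSt (σ x) = true ∧ rsSt (σ y) = true
    then (1 : R) else 0)

/-- The «both» kernel shared by the two differences: `g·1[Sep ∧ pq(σ x) ∧ rs(σ x) ∧ rs(σ y)]`. -/
noncomputable def kerBoth (σ : Config E → St6) (g : St6 → R) (x y w : Config E) : R :=
  g (σ w) * (if sepSt (σ x) = true ∧ sepSt (σ y) = true ∧ pqSt (σ x) = true ∧ rsSt (σ x) = true ∧
    rsSt (σ y) = true then (1 : R) else 0)

/-- The asymmetric remainder: `g·1[Sep ∧ pq(σ x) ∧ pq(σ y) ∧ rs(σ x) ∧ ¬ rs(σ y)]`. -/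
noncomputable def kerAsym (σ : Config E → St6) (g : St6 → R) (x y w : Config E) : R :=
  g (σ w) * (if sepSt (σ x) = true ∧ sepSt (σ y) = true ∧ pqSt (σ x) = true ∧ pqSt (σ y) = true ∧
    rsSt (σ x) = true ∧ rsSt (σ y) = false then (1 : R) else 0)

omit [Fintype E] [DecidableEq E] in
/-- Pointwise: `Src' = Src + Both + Asym`. -/
lemma kerM9Src'_eq (σ : Config E → St6) (g : St6 → R) (x y w : Config E) :
    kerM9Src' σ g x y w = kerM9Src σ g x y w + kerBoth σ g x y w + kerAsym σ g x y w := by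
  unfold kerM9Src' kerM9Src kerBoth kerAsym
  simp only [eq_pqrs_iff, eq_sep_iff]
  cases sepSt (σ x) <;> cases sepSt (σ y) <;> cases pqSt (σ x) <;> cases pqSt (σ y) <;>
    cases rsSt (σ x) <;> cases rsSt (σ y) <;> simp

omit [Fintype E] [DecidableEq E] in
/-- Pointwise: `Tgt' = Tgt + Both + Asym∘swap`. -/
lemma kerM9Tgt'_eq (σ : Config E → St6) (g : St6 → R) (x y w : Config E) :
    kerM9Tgt' σ g x y w = kerM9Tgt σ g x y w + kerBoth σ g x y w + kerAsym σ g y x w := by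
  unfold kerM9Tgt' kerM9Tgt kerBoth kerAsym
  simp only [eq_pq_iff, eq_rs_iff]
  cases sepSt (σ x) <;> cases sepSt (σ y) <;> cases pqSt (σ x) <;> cases pqSt (σ y) <;>
    cases rsSt (σ x) <;> cases rsSt (σ y) <;> simp

/-- **The primed identity for m9.**  For every monotone-or-not state map `σ` and every spectator
weight `g`: `c(Src') − c(Tgt') = c(Src) − c(Tgt)` — the «both» classes cancel, the asymmetric
class after the reflection of the two copies (`typedCount_swap12`). -/
theorem typedCount_m9_primed_identity (F : Finset E) (z : Config E) (τ : E → ℕ)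
    (σ : Config E → St6) (g : St6 → R) :
    typedCount F z τ (kerM9Src' σ g) - typedCount F z τ (kerM9Tgt' σ g) =
      typedCount F z τ (kerM9Src σ g) - typedCount F z τ (kerM9Tgt σ g) := by
  have h1 : typedCount F z τ (kerM9Src' σ g) =
      typedCount F z τ (kerM9Src σ g) + typedCount F z τ (kerBoth σ g) +
        typedCount F z τ (kerAsym σ g) := by
    rw [← typedCount_add', ← typedCount_add']
    exact typedCount_congr' F z τ _ _ (kerM9Src'_eq σ g)
  have h2 : typedCount F z τ (kerM9Tgt' σ g) =
      typedCount F z τ (kerM9Tgt σ g) + typedCount F z τ (kerBoth σ g) +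
        typedCount F z τ (kerAsym σ g) := by
    rw [← typedCount_swap12 F z τ (kerAsym σ g), ← typedCount_add', ← typedCount_add']
    exact typedCount_congr' F z τ _ _ (kerM9Tgt'_eq σ g)
  rw [h1, h2]; ring

/-- The sign kernel `g(σ w)·1[Sep]·(pq(x) − pq(y))·(rs(x) − rs(y))` (bits as `0/1` in `R`). -/
noncomputable def kerSign (σ : Config E → St6) (g : St6 → R) (x y w : Config E) : R :=
  g (σ w) * (if sepSt (σ x) = true ∧ sepSt (σ y) = true then (1 : R) else 0) *
    (((if pqSt (σ x) = true then (1 : R) else 0) - (if pqSt (σ y) = true then (1 : R) else 0)) *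
      ((if rsSt (σ x) = true then (1 : R) else 0) - (if rsSt (σ y) = true then (1 : R) else 0)))

omit [Fintype E] [DecidableEq E] in
/-- Pointwise: the sign kernel is `Src' − Tgt' + Src'∘swap − Tgt'∘swap`. -/
lemma kerSign_eq (σ : Config E → St6) (g : St6 → R) (x y w : Config E) :
    kerSign σ g x y w = (kerM9Src' σ g x y w - kerM9Tgt' σ g x y w) +
      (kerM9Src' σ g y x w - kerM9Tgt' σ g y x w) := by
  unfold kerSign kerM9Src' kerM9Tgt'
  cases sepSt (σ x) <;> cases sepSt (σ y) <;> cases pqSt (σ x) <;> cases pqSt (σ y) <;>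
    cases rsSt (σ x) <;> cases rsSt (σ y) <;> simp

/-- The typed count of the sign kernel is twice the primed difference. -/
theorem typedCount_kerSign (F : Finset E) (z : Config E) (τ : E → ℕ)
    (σ : Config E → St6) (g : St6 → R) :
    typedCount F z τ (kerSign σ g) =
      2 * (typedCount F z τ (kerM9Src' σ g) - typedCount F z τ (kerM9Tgt' σ g)) := by
  have hs : typedCount F z τ (fun x y w => kerM9Src' σ g y x w - kerM9Tgt' σ g y x w) =
      typedCount F z τ (fun x y w => kerM9Src' σ g x y w - kerM9Tgt' σ g x y w) :=
    typedCount_swap12 F z τ (fun x y w => kerM9Src' σ g x y w - kerM9Tgt' σ g x y w)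
  have hd : typedCount F z τ (fun x y w => kerM9Src' σ g x y w - kerM9Tgt' σ g x y w) =
      typedCount F z τ (kerM9Src' σ g) - typedCount F z τ (kerM9Tgt' σ g) := by
    rw [sub_eq_add_neg, ← typedCount_neg', ← typedCount_add']
    exact typedCount_congr' F z τ _ _ (fun x y w => by simp [sub_eq_add_neg])
  rw [typedCount_congr' F z τ _ _ (kerSign_eq σ g), typedCount_add', hs, hd]; ring

end Identity

section Iff

variable {E : Type*} [Fintype E] [DecidableEq E] {R : Type*} [Field R] [LinearOrder R]
  [IsStrictOrderedRing R]

/-- **m9 ↔ m9′.**  The move `c(pq|rs, SEP) ≤ c(pq|r|s, rs|p|q)` holds iff its primed form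
`c(Sep ∧ pq(x) ∧ rs(x)) ≤ c(Sep ∧ pq(x) ∧ rs(y))` does. -/
theorem typedCount_m9_iff_primed (F : Finset E) (z : Config E) (τ : E → ℕ)
    (σ : Config E → St6) (g : St6 → R) :
    typedCount F z τ (kerM9Src σ g) ≤ typedCount F z τ (kerM9Tgt σ g) ↔
      typedCount F z τ (kerM9Src' σ g) ≤ typedCount F z τ (kerM9Tgt' σ g) := by
  have h := typedCount_m9_primed_identity F z τ σ g
  constructor
  · intro hle; have := sub_nonpos.mpr hle; rw [← h] at this; exact sub_nonpos.mp this
  · intro hle; have := sub_nonpos.mpr hle; rw [h] at this; exact sub_nonpos.mp this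

/-- **m9 in sign form.**  `m9 ⟺ Σ_{Sep} g(σ w)·(pq(x) − pq(y))·(rs(x) − rs(y)) ≤ 0`: the colour
preferences of the two pairs are negatively correlated given their mutual separation. -/
theorem typedCount_m9_iff_sign (F : Finset E) (z : Config E) (τ : E → ℕ)
    (σ : Config E → St6) (g : St6 → R) :
    typedCount F z τ (kerM9Src σ g) ≤ typedCount F z τ (kerM9Tgt σ g) ↔
      typedCount F z τ (kerSign σ g) ≤ 0 := by
  rw [typedCount_m9_iff_primed, typedCount_kerSign]
  constructor
  · intro h; have := sub_nonpos.mpr h; nlinarith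
  · intro h; have : typedCount F z τ (kerM9Src' σ g) - typedCount F z τ (kerM9Tgt' σ g) ≤ 0 := by
      nlinarith
    exact sub_nonpos.mp this

end Iff

end PairHarris

end CovForm

end Summit.Ventures.PercRepro2
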